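import Summits.QuantumFields.YangMills.Theorems.UnitScaleTiltProp7AccretiveConjDecay
import HarnessLib

/-!
# Route `UnitScaleTilt`, crux K1 «MinimiserStabilityRegPr» (stmt-QuantumFields-19200), EX rows `h349` ∕ `hGF` (curved member) — **LOD LINE ENGINE (L0‴) (★p1 g24): THE HERMITIAN
# «COSH-BUDGET» COMBES–THOMAS BOUND** — for a HERMITIAN accretive matrix the conjugation defect enters the real part of the form only through `cosh(φ_i − φ_j) − 1`
# (the `sinh` part is purely imaginary), so the budget is QUADRATIC in the slope of the weight: `Σ_l (cosh(μ d(i,l)) − 1)‖A i l‖ ≤ ϱ ≤ m∕2 ⟹ ‖A⁻¹ i j‖ ≤ (4∕m)e^{−μ d(i,j)}`.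
# At a T³ member with the FINE-Lipschitz weight (slope `μη` per bond, entries `~η⁻²`, O(1) neighbours) the budget is `6η⁻²(cosh μη − 1) ≤ 6μ²` — K-UNIFORM — where lit's
# `exp`-budget (✓`almostLocal_inverse_decay`) gives `6η⁻²(e^{μη} − 1) ≈ 6μ∕η` (memo §7 (E1)).  This is the L²-Agmon step (L3′a) for the massive scalar propagator made a budget check.

Cell `ym3-torus` (HUMAN RULING D-0037, YM ladder rung R3 — NOT d = 4, NOT a mass gap, NOT Clay).  Fleet lead seat `ym-ust-19200-p1` gen 24; ★★OWNER RULINGS №33∕№34; CARD-19200-V3-g24 §5.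
THEOREMS ONLY (0 `def`, 0 `sorry`), Mathlib + this seat's ✓p746925 `…Prop7AccretiveConjDecay`; `--supports stmt-QuantumFields-19200 --as helper`, count-neutral.  HONEST LABEL (№33 (6)):
curved γ-row supplier line (LOD localisation); ENGINE lemma; the member rows (entries∕stencil of `covLapSite U₀ + aQ″†Q″` in the site⊗fibre basis, its gap (L2′)) are NOT here; nothing of
(3.49), Thm 3.1∕3.3, `h349`, `hGF`, EX ∕ 19200 is proved.

WHAT IS PROVED (ns `Summit.QuantumFields.YangMills.Theorems.Prop7HermitianCoshBudgetCT`; `A : Matrix n n ℂ` Hermitian; conjugate `A_φ := (a,b) ↦ e^{φ a − φ b}·A a b` as in ✓p746925).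
* §1 `re_pair_symm` (the two-term identity `Re((e^{a}−1)z + (e^{−a}−1)z̄) = 2(cosh a − 1)·Re z`), ★★ `re_form_conj_sub_eq_cosh` — for Hermitian `A`:
  `Re Σ_i v̄_i((A_φ − A)v)_i = Σ_i Σ_j (cosh(φ_i − φ_j) − 1)·Re(v̄_i A_{ij} v_j)`; ★★ `re_form_conj_sub_ge_neg_budget` — `≥ −ϱ·Σ|v_i|²` under the row cosh-budget `≤ ϱ` (columns follow by symmetry).
* §2 ★★★ `inv_decay_of_hermitian_coshBudget` — `A` Hermitian, `m`-accretive, `Σ_l (cosh(μ·d(i,l)) − 1)‖A i l‖ ≤ ϱ ≤ m∕2` for every `i` (`d` a pseudo-metric: the weight `μ d(·,j)` is `d`-Lipschitz,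
  and `cosh` is even and monotone) ⟹ `IsUnit A.det ∧ ‖A⁻¹ i j‖ ≤ (4∕m)·e^{−μ d(i,j)}` (via ✓`conj_accretive_of_formRelative` with `θ = 0`, `δ = ϱ`, and ✓`inv_decay_of_conj_accretive_family`).

References: T. Bałaban, CMP **99** (1985) 389–434 [Balaban1985BackgroundPropagators] (Thm 3.1 (3.46) p.398, (3.49) p.399); S. Agmon, *Lectures on exponential decay* (1982) Ch. 1;
CMP **116** (1988) 1–22 [Balaban1988RG2Cluster] ((2.7) p.13).
-/

set_option autoImplicit false

noncomputable section

open scoped Matrix ComplexConjugate BigOperators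
open Finset

namespace Summit.QuantumFields.YangMills.Theorems.Prop7HermitianCoshBudgetCT

open Summit.QuantumFields.YangMills.Theorems.Prop7AccretiveConjDecay (inv_decay_of_conj_accretive_family conj_accretive_of_formRelative)

variable {n : Type*} [Fintype n]

/-! ## §1 The real part of the conjugation defect of a Hermitian form is a `cosh − 1` sum -/

/-- The two-term identity behind Agmon's estimate: `Re((e^{a} − 1)z + (e^{−a} − 1)z̄) = 2(cosh a − 1)·Re z` — the `sinh` part is purely imaginary. [cite: Balaban1985BackgroundPropagators, Thm 3.1 p.397] -/
theorem re_pair_symm (a : ℝ) (z : ℂ) :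
    (((Real.exp a - 1 : ℝ) : ℂ) * z + ((Real.exp (-a) - 1 : ℝ) : ℂ) * (starRingEnd ℂ) z).re = 2 * (Real.cosh a - 1) * z.re := by
  rw [Complex.add_re, Complex.re_ofReal_mul, Complex.re_ofReal_mul, Complex.conj_re, Real.cosh_eq]
  ring

omit [Fintype n] in
/-- The entries of the conjugation defect: `(A_φ − A) a b = (e^{φ a − φ b} − 1)·A a b`. [cite: Balaban1988RG2Cluster, (2.7) p.13] -/
theorem conj_sub_apply (A : Matrix n n ℂ) (φ : n → ℝ) (a b : n) :
    ((Matrix.of fun a b => (Real.exp (φ a - φ b) : ℂ) * A a b) - A) a b = ((Real.exp (φ a - φ b) - 1 : ℝ) : ℂ) * A a b := by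
  rw [Matrix.sub_apply, Matrix.of_apply]; push_cast; ring

/-- ★★ **THE `cosh − 1` FORM OF THE DEFECT** (Hermitian `A`): `Re Σ_i v̄_i((A_φ − A)v)_i = Σ_i Σ_j (cosh(φ_i − φ_j) − 1)·Re(v̄_i A_{ij} v_j)`.
[cite: Balaban1985BackgroundPropagators, Thm 3.1 p.397] -/
theorem re_form_conj_sub_eq_cosh (A : Matrix n n ℂ) (hA : A.IsHermitian) (φ : n → ℝ) (v : n → ℂ) :
    (∑ i, star (v i) * (((Matrix.of fun a b => (Real.exp (φ a - φ b) : ℂ) * A a b) - A) *ᵥ v) i).re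
      = ∑ i, ∑ j, (Real.cosh (φ i - φ j) - 1) * (star (v i) * A i j * v j).re := by
  -- expand the form as a double sum of `f i j := Re( v̄_i (e^{φ_i−φ_j} − 1) A_ij v_j )`
  have hexp : (∑ i, star (v i) * (((Matrix.of fun a b => (Real.exp (φ a - φ b) : ℂ) * A a b) - A) *ᵥ v) i).re
      = ∑ i, ∑ j, (star (v i) * (((Real.exp (φ i - φ j) - 1 : ℝ) : ℂ) * A i j) * v j).re := by
    rw [Complex.re_sum]
    refine Finset.sum_congr rfl fun i _ => ?_
    rw [Matrix.mulVec, dotProduct, Finset.mul_sum, Complex.re_sum]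
    refine Finset.sum_congr rfl fun j _ => ?_
    rw [conj_sub_apply]; ring_nf
  rw [hexp]
  -- symmetrise: `S = ½ (S + Sᵀ)` and the pair identity
  have hsymm : ∑ i, ∑ j, (star (v i) * (((Real.exp (φ i - φ j) - 1 : ℝ) : ℂ) * A i j) * v j).re
      = ∑ i, ∑ j, (star (v j) * (((Real.exp (φ j - φ i) - 1 : ℝ) : ℂ) * A j i) * v i).re := Finset.sum_comm
  have hpair : ∀ i j, (star (v i) * (((Real.exp (φ i - φ j) - 1 : ℝ) : ℂ) * A i j) * v j).re
      + (star (v j) * (((Real.exp (φ j - φ i) - 1 : ℝ) : ℂ) * A j i) * v i).re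
      = 2 * (Real.cosh (φ i - φ j) - 1) * (star (v i) * A i j * v j).re := by
    intro i j
    have hji : A j i = (starRingEnd ℂ) (A i j) := by
      have h := congrFun (congrFun hA.eq j) i
      rw [Matrix.conjTranspose_apply] at h
      rw [← h, Complex.star_def]
    have hz : star (v j) * (((Real.exp (φ j - φ i) - 1 : ℝ) : ℂ) * A j i) * v i
        = ((Real.exp (-(φ i - φ j)) - 1 : ℝ) : ℂ) * (starRingEnd ℂ) (star (v i) * A i j * v j) := by
      rw [hji, neg_sub]
      simp only [map_mul, Complex.star_def, Complex.conj_conj]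
      ring
    have hz' : star (v i) * (((Real.exp (φ i - φ j) - 1 : ℝ) : ℂ) * A i j) * v j = ((Real.exp (φ i - φ j) - 1 : ℝ) : ℂ) * (star (v i) * A i j * v j) := by ring
    rw [hz, hz', ← Complex.add_re, re_pair_symm]
  have h2 : 2 * ∑ i, ∑ j, (star (v i) * (((Real.exp (φ i - φ j) - 1 : ℝ) : ℂ) * A i j) * v j).re
      = ∑ i, ∑ j, 2 * (Real.cosh (φ i - φ j) - 1) * (star (v i) * A i j * v j).re := by
    rw [two_mul]
    nth_rewrite 2 [hsymm]
    rw [← Finset.sum_add_distrib]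
    refine Finset.sum_congr rfl fun i _ => ?_
    rw [← Finset.sum_add_distrib]
    exact Finset.sum_congr rfl fun j _ => hpair i j
  have h3 : ∑ i, ∑ j, 2 * (Real.cosh (φ i - φ j) - 1) * (star (v i) * A i j * v j).re
      = 2 * ∑ i, ∑ j, (Real.cosh (φ i - φ j) - 1) * (star (v i) * A i j * v j).re := by
    rw [Finset.mul_sum]; refine Finset.sum_congr rfl fun i _ => ?_
    rw [Finset.mul_sum]; refine Finset.sum_congr rfl fun j _ => ?_; ring
  linarith [h2.trans h3]

/-- ★★ **THE COSH-BUDGET LOWER BOUND**: for Hermitian `A` with `Σ_j (cosh(φ_i − φ_j) − 1)‖A i j‖ ≤ ϱ` for every `i`,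
`Re Σ v̄((A_φ − A)v) ≥ −ϱ·Σ|v_i|²`. [cite: Balaban1985BackgroundPropagators, Thm 3.1 p.397] -/
theorem re_form_conj_sub_ge_neg_budget (A : Matrix n n ℂ) (hA : A.IsHermitian) (φ : n → ℝ) {ϱ : ℝ}
    (hrow : ∀ i, ∑ j, (Real.cosh (φ i - φ j) - 1) * ‖A i j‖ ≤ ϱ) (v : n → ℂ) :
    -(ϱ * ∑ i, ‖v i‖ ^ 2) ≤ (∑ i, star (v i) * (((Matrix.of fun a b => (Real.exp (φ a - φ b) : ℂ) * A a b) - A) *ᵥ v) i).re := by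
  rw [re_form_conj_sub_eq_cosh A hA φ v]
  have hc : ∀ i j, 0 ≤ Real.cosh (φ i - φ j) - 1 := fun i j => by linarith [Real.one_le_cosh (φ i - φ j)]
  -- termwise: `(cosh − 1)·Re(v̄_i A_ij v_j) ≥ −(cosh − 1)‖A i j‖ (|v_i|² + |v_j|²)/2`
  have hterm : ∀ i j, -((Real.cosh (φ i - φ j) - 1) * ‖A i j‖ * ((‖v i‖ ^ 2 + ‖v j‖ ^ 2) / 2))
      ≤ (Real.cosh (φ i - φ j) - 1) * (star (v i) * A i j * v j).re := by
    intro i j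
    have h1 : |(star (v i) * A i j * v j).re| ≤ ‖v i‖ * ‖A i j‖ * ‖v j‖ := by
      refine (Complex.abs_re_le_norm _).trans ?_
      rw [norm_mul, norm_mul, norm_star]
    have h2 : ‖v i‖ * ‖A i j‖ * ‖v j‖ ≤ ‖A i j‖ * ((‖v i‖ ^ 2 + ‖v j‖ ^ 2) / 2) := by
      nlinarith [sq_nonneg (‖v i‖ - ‖v j‖), norm_nonneg (A i j), norm_nonneg (v i), norm_nonneg (v j)]
    have h3 := (abs_le.mp (h1.trans h2)).1
    nlinarith [hc i j]
  have hsum : -(∑ i, ∑ j, (Real.cosh (φ i - φ j) - 1) * ‖A i j‖ * ((‖v i‖ ^ 2 + ‖v j‖ ^ 2) / 2))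
      ≤ ∑ i, ∑ j, (Real.cosh (φ i - φ j) - 1) * (star (v i) * A i j * v j).re := by
    rw [← Finset.sum_neg_distrib]
    refine Finset.sum_le_sum fun i _ => ?_
    rw [← Finset.sum_neg_distrib]
    exact Finset.sum_le_sum fun j _ => hterm i j
  refine le_trans ?_ hsum
  -- the symmetric budget: split `(|v_i|² + |v_j|²)/2`, swap the second sum, use `cosh` even and `‖A j i‖ = ‖A i j‖`
  have hsplit : ∑ i, ∑ j, (Real.cosh (φ i - φ j) - 1) * ‖A i j‖ * ((‖v i‖ ^ 2 + ‖v j‖ ^ 2) / 2)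
      = (∑ i, ∑ j, (Real.cosh (φ i - φ j) - 1) * ‖A i j‖ * ‖v i‖ ^ 2) / 2
        + (∑ i, ∑ j, (Real.cosh (φ i - φ j) - 1) * ‖A i j‖ * ‖v j‖ ^ 2) / 2 := by
    rw [← add_div, ← Finset.sum_add_distrib, Finset.sum_div]
    refine Finset.sum_congr rfl fun i _ => ?_
    rw [← Finset.sum_add_distrib, Finset.sum_div]
    refine Finset.sum_congr rfl fun j _ => ?_
    ring
  have hswap : ∑ i, ∑ j, (Real.cosh (φ i - φ j) - 1) * ‖A i j‖ * ‖v j‖ ^ 2 = ∑ i, ∑ j, (Real.cosh (φ i - φ j) - 1) * ‖A i j‖ * ‖v i‖ ^ 2 := by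
    rw [Finset.sum_comm]
    refine Finset.sum_congr rfl fun i _ => Finset.sum_congr rfl fun j _ => ?_
    have hn : ‖A j i‖ = ‖A i j‖ := by
      have h := congrFun (congrFun hA.eq j) i
      rw [Matrix.conjTranspose_apply] at h
      rw [← h, norm_star]
    rw [hn, ← Real.cosh_neg (φ j - φ i), neg_sub]
  have hrows : ∑ i, ∑ j, (Real.cosh (φ i - φ j) - 1) * ‖A i j‖ * ‖v i‖ ^ 2 ≤ ϱ * ∑ i, ‖v i‖ ^ 2 := by
    rw [Finset.mul_sum]
    refine Finset.sum_le_sum fun i _ => ?_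
    rw [← Finset.sum_mul]
    exact mul_le_mul_of_nonneg_right (hrow i) (by positivity)
  rw [hsplit, hswap]
  linarith

/-! ## §2 The Hermitian cosh-budget Combes–Thomas bound -/

/-- ★★★ **HERMITIAN COSH-BUDGET COMBES–THOMAS**: `A` Hermitian and `m`-accretive (`m > 0`), `d` a pseudo-metric with `d i i = 0`, symmetry and the triangle inequality, and the
COSH-budget `Σ_l (cosh(μ d(i,l)) − 1)·‖A i l‖ ≤ ϱ ≤ m∕2` for every row `i` (`0 ≤ μ`) ⟹ `A` is invertible and `‖A⁻¹ i j‖ ≤ (4∕m)·e^{−μ d(i,j)}`.  (The weight `μ d(·,j)` is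
`d`-Lipschitz, `cosh` is even and monotone, so the `j`-dependent budget is dominated by the displayed one; then ✓`conj_accretive_of_formRelative` with `θ = 0` and
✓`inv_decay_of_conj_accretive_family`.)  Member use: entries `~η⁻²`, slope `μη` per bond ⟹ budget `6η⁻²(cosh μη − 1) ≤ 6μ²`, K-uniform.
[cite: Balaban1985BackgroundPropagators, Thm 3.1 (3.46) p.398, (3.49) p.399] -/
theorem inv_decay_of_hermitian_coshBudget [DecidableEq n] (d : n → n → ℝ) (hd0 : ∀ i, d i i = 0) (hds : ∀ i j, d i j = d j i)
    (hdt : ∀ i j k, d i k ≤ d i j + d j k) (A : Matrix n n ℂ) (hA : A.IsHermitian) {m μ ϱ : ℝ} (hm : 0 < m) (hμ : 0 ≤ μ) (hϱm : ϱ ≤ m / 2)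
    (hacc : ∀ v : n → ℂ, m * ∑ i, ‖v i‖ ^ 2 ≤ (∑ i, star (v i) * (A *ᵥ v) i).re)
    (hrow : ∀ i, ∑ l, (Real.cosh (μ * d i l) - 1) * ‖A i l‖ ≤ ϱ) :
    IsUnit A.det ∧ ∀ i j, ‖A⁻¹ i j‖ ≤ 4 / m * Real.exp (-(μ * d i j)) := by
  -- the conjugate by `μ d(·, j₀)` is `(m − ϱ)`-accretive for every column `j₀`
  have hconj : ∀ (j₀ : n) (v : n → ℂ), (m - ϱ) * ∑ i, ‖v i‖ ^ 2 ≤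
      (∑ i, star (v i) * ((Matrix.of fun a b => (Real.exp (μ * d a j₀ - μ * d b j₀) : ℂ) * A a b) *ᵥ v) i).re := by
    intro j₀ v
    have hbudget : ∀ i, ∑ l, (Real.cosh ((fun a => μ * d a j₀) i - (fun a => μ * d a j₀) l) - 1) * ‖A i l‖ ≤ ϱ := by
      intro i
      refine le_trans (Finset.sum_le_sum fun l _ => ?_) (hrow i)
      refine mul_le_mul_of_nonneg_right ?_ (norm_nonneg _)
      -- `|μ d(i,j₀) − μ d(l,j₀)| ≤ μ d(i,l)` and `cosh` is even, monotone on `[0,∞)`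
      have hlip : |μ * d i j₀ - μ * d l j₀| ≤ μ * d i l := by
        rw [← mul_sub, abs_mul, abs_of_nonneg hμ]
        refine mul_le_mul_of_nonneg_left (abs_sub_le_iff.mpr ⟨?_, ?_⟩) hμ
        · have := hdt i l j₀; linarith
        · have := hdt l i j₀; rw [hds l i] at this; linarith
      have h : Real.cosh (μ * d i j₀ - μ * d l j₀) ≤ Real.cosh (μ * d i l) := Real.cosh_le_cosh.mpr (hlip.trans (le_abs_self _))
      linarith
    have h := conj_accretive_of_formRelative A (Matrix.of fun a b => (Real.exp ((fun a => μ * d a j₀) a - (fun a => μ * d a j₀) b) : ℂ) * A a b)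
      (θ := 0) (δ := ϱ) (m := m) zero_le_one hacc (fun w => by
        have hb := re_form_conj_sub_ge_neg_budget A hA (fun a => μ * d a j₀) hbudget w
        simpa using hb) v
    simpa using h
  have hm' : 0 < m - ϱ := by linarith
  obtain ⟨hunit, hdec⟩ := inv_decay_of_conj_accretive_family d hd0 A hm hm' hacc hconj
  refine ⟨hunit, fun i j => (hdec i j).trans ?_⟩
  have h4 : 2 / (m - ϱ) ≤ 4 / m := by
    rw [div_le_div_iff₀ hm' hm]; nlinarith
  exact mul_le_mul_of_nonneg_right h4 (Real.exp_pos _).le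

end Summit.QuantumFields.YangMills.Theorems.Prop7HermitianCoshBudgetCT

end
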